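import Summits.QuantumFields.YangMills.Theorems.FluctuationComparisonRegPrIntLOrganTangentFibreMeanTools
import Mathlib.Topology.ContinuousMap.SecondCountableSpace
import Mathlib.MeasureTheory.Integral.BoundedContinuousFunction
import Literature.MathematicalPhysics.QuantumFieldTheory.Balaban1983to89.T3UnitScaleTilt
import Literature.MathematicalPhysics.QuantumFieldTheory.Balaban1983to89.T3OrbitAverage
import HarnessLib

/-!
# Crux `FluctuationComparisonRegPrIntL` (stmt-QuantumFields-20520, rung R3), PATH-B organ O1, LINE g25-3 «version_coarea», row COAREA∘
# `RegularFibrePackageCan` — SUPPORT LEMMA «THE SEPARABILITY SWAP»: a fibre identity `∫ g dκ₁(a) = c(a)·∫ g dκ₂(a)` that holds, FOR EACH continuous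
# test function `g` of a class, for a.e. `a`, holds for a.e. `a` SIMULTANEOUSLY FOR ALL `g` of the class (LEAD WORD №10 (α), step (s))

LEAD-20520 width seat ym-ust-20520-w3 g23 (cell ym3-torus), `--supports stmt-QuantumFields-20520` (helper).  THEOREMS ONLY, def-free.

WHY: COAREA∘'s DISINT clause puts the test function INSIDE the a.e. (`∀ᵐ V, … ∀ g, …`), the (A)-package's (A3) puts it OUTSIDE (`∀ f, ∀ᵐ V, …`) so that
a fibred chart supplies it one `f` at a time (census v1.2 §2).  Going back costs exactly this [folklore] swap: `C(X, ℝ)` is separable for a compact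
second-countable Hausdorff `X` (Mathlib `ContinuousMap.instSeparableSpace`), any test class `G ⊆ C(X, ℝ)` inherits a countable dense subset, the a.e.
statement for countably many `g` is one a.e. statement, and both sides of the identity are continuous in `g` for the sup norm against finite measures.
§1 ★`ae_forall_integral_eq_of_forall_ae` (generic `X`, any `G : Set C(X, ℝ)`, any finite-measure families `κ₁ κ₂`, weight `c`, guard `Q`);
§2 ★`ae_forall_fibreIdentity_of_forall_ae` — the T³ reading for plain functions `g` «continuous and vanishing off `{PlaqSmall (cW·θ_{j+1})}`», guard =
the coarse window, as in COAREA∘ ∕ (A3).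

HONEST FRAMING: measure theory∕topology; nothing of Bałaban's analysis is asserted or proved; COAREA∘, O1, crux 20520, `YM3TorusSU2` are NOT proved here;
registry `Lines/semiclassical_s2beta.lean` v11.4 (★★OWNER RULING №36) untouched; rung R3 = SU(2) YM₃ on T³ — NOT d = 4, NOT infinite volume, NOT a mass gap,
NOT Clay; the Yang–Mills mass gap is NOT proved by any of this.
-/

set_option autoImplicit false

noncomputable section

namespace Summit.QuantumFields.YangMills.Theorems.OrganTangentSeparabilitySwap

open MeasureTheory Filter Topology Set TopologicalSpace
open scoped ENNReal NNReal BoundedContinuousFunction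
open Literature.MathematicalPhysics.QuantumFieldTheory.Balaban1983to89
open T3ContinuumYM3Torus T3NestedUnitLaws T3UnitLawDensityEML T3UnitScaleTilt
open Literature.MathematicalPhysics.QuantumFieldTheory.Balaban1983to89.T3OrbitAverage

/-! ## §1 Generic: countably many a.e. identities + sup-norm continuity ⟹ one a.e. identity for the whole class -/

/-- Integrals of continuous maps against a finite measure on a compact space converge along sup-norm convergent sequences. [folklore] -/
theorem tendsto_integral_of_tendsto_continuousMap
    {X : Type*} [TopologicalSpace X] [CompactSpace X] [MeasurableSpace X] [OpensMeasurableSpace X]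
    (κ : Measure X) [IsFiniteMeasure κ] {u : ℕ → C(X, ℝ)} {g : C(X, ℝ)} (hu : Tendsto u atTop (𝓝 g)) :
    Tendsto (fun n => ∫ x, u n x ∂κ) atTop (𝓝 (∫ x, g x ∂κ)) := by
  rw [tendsto_iff_norm_sub_tendsto_zero]
  have hn : Tendsto (fun n => ‖u n - g‖ * (κ univ).toReal) atTop (𝓝 0) := by
    have h1 : Tendsto (fun n => ‖u n - g‖) atTop (𝓝 0) := (tendsto_iff_norm_sub_tendsto_zero.mp hu)
    simpa using h1.mul_const (κ univ).toReal
  refine squeeze_zero (fun n => norm_nonneg _) (fun n => ?_) hn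
  have hi : ∀ f : C(X, ℝ), Integrable (fun x => f x) κ := fun f =>
    OrganTangentFibreMeanTools.integrable_of_continuous_compact f.continuous κ
  rw [← integral_sub (hi (u n)) (hi g)]
  refine norm_integral_le_of_norm_le_const (Eventually.of_forall fun x => ?_)
  have := (u n - g).norm_coe_le_norm x
  simpa using this

/-- ★ **THE SEPARABILITY SWAP.** [folklore] [cite: Balaban1985Averaging, (10)-(13) p.19] -/
theorem ae_forall_integral_eq_of_forall_ae
    {α X : Type*} [MeasurableSpace α] {μ : Measure α}
    [TopologicalSpace X] [CompactSpace X] [T2Space X] [SecondCountableTopology X] [MeasurableSpace X] [OpensMeasurableSpace X]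
    (G : Set C(X, ℝ)) (κ₁ κ₂ : α → Measure X) (hκ₁ : ∀ a, IsFiniteMeasure (κ₁ a)) (hκ₂ : ∀ a, IsFiniteMeasure (κ₂ a))
    (c : α → ℝ) (Q : α → Prop)
    (h : ∀ g ∈ G, ∀ᵐ a ∂μ, Q a → ∫ x, g x ∂(κ₁ a) = c a * ∫ x, g x ∂(κ₂ a)) :
    ∀ᵐ a ∂μ, Q a → ∀ g ∈ G, ∫ x, g x ∂(κ₁ a) = c a * ∫ x, g x ∂(κ₂ a) := by
  -- a countable sup-dense family inside `G`
  have hsep : IsSeparable G := IsSeparable.of_separableSpace G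
  haveI : SeparableSpace G := hsep.separableSpace
  obtain ⟨D, hDc, hDd⟩ := exists_countable_dense G
  have hD : ∀ᵐ a ∂μ, ∀ d ∈ D, Q a → ∫ x, (d : C(X, ℝ)) x ∂(κ₁ a) = c a * ∫ x, (d : C(X, ℝ)) x ∂(κ₂ a) :=
    (eventually_countable_ball hDc).mpr fun d _ => h d.1 d.2
  filter_upwards [hD] with a ha hQ g hg
  haveI := hκ₁ a
  haveI := hκ₂ a
  -- approximate `g` from `D`
  have hmem : (⟨g, hg⟩ : G) ∈ closure D := by rw [hDd.closure_eq]; exact mem_univ _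
  obtain ⟨u, huD, hu⟩ := mem_closure_iff_seq_limit.mp hmem
  have hu' : Tendsto (fun n => ((u n : G) : C(X, ℝ))) atTop (𝓝 g) :=
    (continuous_subtype_val.tendsto _).comp hu
  have h1 := tendsto_integral_of_tendsto_continuousMap (κ₁ a) hu'
  have h2 := (tendsto_integral_of_tendsto_continuousMap (κ₂ a) hu').const_mul (c a)
  have heq : (fun n => ∫ x, ((u n : G) : C(X, ℝ)) x ∂(κ₁ a)) = fun n => c a * ∫ x, ((u n : G) : C(X, ℝ)) x ∂(κ₂ a) :=
    funext fun n => ha (u n) (huD n) hQ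
  rw [heq] at h1
  exact tendsto_nhds_unique h1 h2

/-! ## §2 The T³ reading: test functions «continuous, vanishing off the `cW`-window», guard = the coarse window -/

/-- ★ **The swap for COAREA∘'s test class.** [cite: Balaban1985Averaging, (10)-(13) p.19; Balaban1987RG1, (0.13) p.254] -/
theorem ae_forall_fibreIdentity_of_forall_ae
    (F : T3Family) (γ b₀ p₀ : ℝ) (j : ℕ) (cW : ℝ)
    (μ : Measure (GaugeField (F.P j) 0 ↥(Matrix.specialUnitaryGroup (Fin 2) ℂ)))
    (κ₁ κ₂ : GaugeField (F.P j) 0 ↥(Matrix.specialUnitaryGroup (Fin 2) ℂ) → Measure (GaugeField (F.P (j + 1)) 0 ↥(Matrix.specialUnitaryGroup (Fin 2) ℂ)))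
    (hκ₁ : ∀ V, IsFiniteMeasure (κ₁ V)) (hκ₂ : ∀ V, IsFiniteMeasure (κ₂ V))
    (c : GaugeField (F.P j) 0 ↥(Matrix.specialUnitaryGroup (Fin 2) ℂ) → ℝ)
    (h : ∀ g : GaugeField (F.P (j + 1)) 0 ↥(Matrix.specialUnitaryGroup (Fin 2) ℂ) → ℝ, Continuous g →
      (∀ U, ¬ PlaqSmall (cW * θBal F.L γ b₀ p₀ (j + 1)) U → g U = 0) →
      ∀ᵐ V ∂μ, PlaqSmall (θBal F.L γ b₀ p₀ j) V → ∫ U, g U ∂(κ₁ V) = c V * ∫ U, g U ∂(κ₂ V)) :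
    ∀ᵐ V ∂μ, PlaqSmall (θBal F.L γ b₀ p₀ j) V →
      ∀ g : GaugeField (F.P (j + 1)) 0 ↥(Matrix.specialUnitaryGroup (Fin 2) ℂ) → ℝ, Continuous g →
        (∀ U, ¬ PlaqSmall (cW * θBal F.L γ b₀ p₀ (j + 1)) U → g U = 0) →
        ∫ U, g U ∂(κ₁ V) = c V * ∫ U, g U ∂(κ₂ V) := by
  haveI : BorelSpace (GaugeField (F.P (j + 1)) 0 ↥(Matrix.specialUnitaryGroup (Fin 2) ℂ)) := instBorelSpaceGaugeField
  set G : Set C(GaugeField (F.P (j + 1)) 0 ↥(Matrix.specialUnitaryGroup (Fin 2) ℂ), ℝ) :=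
    {g | ∀ U, ¬ PlaqSmall (cW * θBal F.L γ b₀ p₀ (j + 1)) U → g U = 0} with hG
  have h' := ae_forall_integral_eq_of_forall_ae (μ := μ) G κ₁ κ₂ hκ₁ hκ₂ c (fun V => PlaqSmall (θBal F.L γ b₀ p₀ j) V)
    fun g hg => h g g.continuous hg
  filter_upwards [h'] with V hV hVW g hgc hg0
  exact hV hVW ⟨g, hgc⟩ hg0

end Summit.QuantumFields.YangMills.Theorems.OrganTangentSeparabilitySwap

end
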